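/-
Copyright: the b2b-balaban T⁴-continuum CRUX team, row NE7b OWNER lineage `t4-ne7b-p1` (gen 129). Project licence.
-/
import Summits.QuantumFields.BalabanUV.T4Continuum.Spine.NE7b.SupSmallFieldGasReal
import Summits.QuantumFields.BalabanUV.T4Continuum.Spine.NE7b.LogConcaveMarginalDeriv

/-!
# THE STEP'S EFFECTIVE ACTION IS DIFFERENTIABLE IN THE EXTERNAL FIELD AT EVERY POINT, WITH DERIVATIVE THE TILTED MEAN OF THE
# REMAINDER'S DERIVATIVE: for `C¹` remainders `w_x` with `|w_x'(t)| ≤ κ₁|t|` and stability `w_x(t) ≥ −κ₀t²`, over a Gaussian scale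
# `N(0,Γ)` with a regulator margin (`(2κ₀(1+τ) + 4δ)γ_op ≤ θ < 1`, `δ > 0`),
#   `D_ψ(−log ∫e^{−Σ_{p∈C}Σ_{x∈cell p}w_x(ω_x+ψ_x)}dN(0,Γ))(ψ₀) = Z(ψ₀)⁻¹ • ∫ e^{−V(ψ₀,ω)} • Σ_{p∈C}Σ_{x∈cell p} w_x'(ω_x+ψ₀,x)·dψ_x dN(0,Γ)(ω)`
# at EVERY `ψ₀` — (28)'s dominated differentiation of a fibre integral with every letter discharged by the Gaussian regulator (row NE7b,
# node U5c; (28) `LogConcaveMarginalDeriv.hasFDerivAt_neg_log_fibreIntegral` + (288)∕(297) BY NAME; [folklore])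

Cell `pub-balaban`, sub-cell `t4`, spine estimate NE7b (`T4WeightBudget.RelWeightBound`; the cell's OWN estimate — NOT PRINTED in
[Bałaban 1983–89], NOT PROVED).  Crux-route work under `Spine/NE7b/` by the row OWNER (`t4-ne7b-p1` gen 129, file (313)) under FREEZE
(0)'s crux-prover clause, on § [NE7bP1-G128-HANDOFF] NEXT (3)(c) (what the ITERATION consumes: the TAYLOR structure of the next potential
`−log Z_ψ` in `ψ`); NOTHING of Bałaban's is named as a Lean object, valued or asserted; no `T4Continuum/Support` leaf typed; no `def`, no
notation; zero `sorry`.  Imports (BY NAME): the OWNER's (28) `…LogConcaveMarginalDeriv` (`hasFDerivAt_neg_log_fibreIntegral`,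
`hasFDerivAt_fibreIntegral`), (306) `…SupSmallFieldGasReal` (`measurable_cellSum`, `cellSum_eq_sum_biUnion`) and through it (297)
(`neg_sum_le_of_stable`, `integrable_exp_neg`), (292) (`sum_add_sq_le`), (288) (`integrable_exp_half_sq_on`); Mathlib's `EuclideanSpace.proj`,
`PiLp.norm_apply_le`, `EuclideanSpace.real_norm_sq_eq`, `HasDerivAt.comp_hasFDerivAt`, `HasFDerivAt.fun_sum`, `integral_exp_pos`,
`ContinuousLinearMap.integral_apply`.

WHY (located).  (307)–(312) control the size and the locality of the next potential `−log Z_ψ`; to ITERATE, the next step must again extract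
a background, a Hessian and a remainder from it — it needs derivatives in `ψ`.  The first derivative exists at every `ψ` with NO
small-field hypothesis and is the tilted expectation of `Σ w_x'(ω_x+ψ_x)dψ_x`: (28)'s theorem, once the base derivative
`e^{−V(ψ,ω)}‖D_ψV(ψ,ω)‖` is dominated, uniformly for `ψ` in the unit ball about `ψ₀`, by ONE Gaussian-integrable function of `ω` — which
stability (`e^{−V} ≤ e^{κ₀(1+τ)Σω² + κ₀(1+τ⁻¹)Σψ²}`), linear growth of `w'` (`|w'(t)| ≤ κ₁|t| ≤ κ₁(1+t²)`), `Σω² ≤ δ⁻¹e^{δΣω²}` and (288)'s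
regulator integrability supply.

WHAT IS PROVED ([folklore]; `μ = N(0,Γ)` on `ι → ℝ`, `Γ ⪰ 0`, `Γ ⪯ γ_op·1`; cells `cell : V → Finset ι` pairwise disjoint; `w_x` with
`HasDerivAt (w x) (w' x t) t`, `w'_x` measurable, `|w'_x(t)| ≤ κ₁|t|`, `−κ₀t² ≤ w_x(t)`; `V(ψ,ω) = Σ_{p∈C}Σ_{x∈cell p}w_x(ω_x+ψ_x)`,
`D(ψ,ω) = Σ_{p∈C}Σ_{x∈cell p} w'_x(ω_x+ψ_x) • proj_x`):
* §1 calculus ∕ size: `hasFDerivAt_cellSum` (`D_ψV(ψ,ω) = D(ψ,ω)`), `norm_cellDeriv_le`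
  (`‖D(ψ,ω)‖ ≤ κ₁(#Y + 2Σ_Yω² + 2Σ_Yψ²)`, `Y = ⋃cells`), `sum_sq_ball_le` (`‖ψ−ψ₀‖ ≤ 1 ⟹ Σ_Yψ² ≤ 2Σ_Yψ₀² + 2`), `mul_opBound_le_of_le`,
  `aestronglyMeasurable_cellDeriv`, `cellDeriv_apply`;
* §2 THE DOMINATION **`step_domination`**: on `closedBall ψ₀ 1`,
  `e^{−V(ψ,ω)}‖D(ψ,ω)‖ ≤ κ₁e^{κ₀(1+τ⁻¹)M}(#Y + 2M + δ⁻¹)·e^{½(2κ₀(1+τ)+4δ)Σ_Yω²}`, `M = 2Σ_Yψ₀² + 2`, and its integrability;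
* §3 THE END **`hasFDerivAt_neg_log_step`** (at EVERY `ψ₀`:
  `HasFDerivAt (ψ ↦ −log ∫e^{−V(ψ,ω)}dμ) (Z(ψ₀)⁻¹ • ∫ e^{−V(ψ₀,ω)} • D(ψ₀,ω) dμ) ψ₀`), `hasFDerivAt_step` (the integral itself),
  `integrable_weighted_cellDeriv` + **`fderiv_neg_log_step_apply`** (the derivative applied to `h` is the tilted mean of
  `Σ_{p∈C}Σ_{x∈cell p}w'_x(ω_x+ψ₀,x)h_x`); §4 toy.

HONEST (what this is NOT).  First derivative only (the Hessian in `ψ` — the Brascamp–Lieb ∕ covariance formula — and the third-order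
remainder of the NEXT potential, i.e. the re-entry into the road's class with improved constants, are the successor's); no smallness used or
produced here (size bounds on the tilted mean are (307)∕(311)'s business); scalar skeleton ((A3), NC-NE7b-α UNRULED); nothing of Bałaban's
asserted.  BY-NAME EFFECT ON THE WALL: NONE.  NE7b NOT PRINTED ∕ NOT PROVED; spine PROVED 0∕9; rung (B)+1 — the programme's measures remain
FINITE-torus statements; NOT the mass gap, NOT Clay.  HONEST DEPENDENCY: continuum YM on T⁴ ⇐ BetaPertH ∧ nine spine estimates (0∕9
proved); BetaPertH ⇐ (D1) ∧ (D4) ∧ CAP+tail; G-an2-4 gates asym, D1 and NE2∕3∕4.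
-/

set_option autoImplicit false

noncomputable section

namespace Summit.QuantumFields.BalabanUV.T4Continuum.NE7b.SupEffectiveActionDerivative

open MeasureTheory ProbabilityTheory Finset Real Metric
open scoped BigOperators Topology
open SupSmallFieldGasReal (measurable_cellSum cellSum_eq_sum_biUnion)
open SupFluctuationAPriori (neg_sum_le_of_stable integrable_exp_neg)
open SupRegulatedActivityShift (sum_add_sq_le)
open SupGaussianRegulator (integrable_exp_half_sq_on)
open LogConcaveMarginalDeriv (hasFDerivAt_neg_log_fibreIntegral hasFDerivAt_fibreIntegral)

variable {ι : Type} [Fintype ι] [DecidableEq ι] {V : Type*}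

/-! ## §1. Calculus and size of the base derivative -/

omit [DecidableEq ι] in
/-- **THE BASE DERIVATIVE OF THE EXPONENT**: `ψ ↦ Σ_{p∈C}Σ_{x∈cell p}w_x(ω_x+ψ_x)` has Fréchet derivative
`Σ_{p∈C}Σ_{x∈cell p} w'_x(ω_x+ψ_x) • proj_x` at every `ψ`. [folklore] -/
theorem hasFDerivAt_cellSum (cell : V → Finset ι) {w w' : ι → ℝ → ℝ} (hw' : ∀ x t, HasDerivAt (w x) (w' x t) t) (C : Finset V)
    (ω ψ : EuclideanSpace ℝ ι) :
    HasFDerivAt (fun ψ' : EuclideanSpace ℝ ι => ∑ p ∈ C, ∑ x ∈ cell p, w x (ω x + ψ' x))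
      (∑ p ∈ C, ∑ x ∈ cell p, (w' x (ω x + ψ x)) • (EuclideanSpace.proj x : EuclideanSpace ℝ ι →L[ℝ] ℝ)) ψ := by
  refine HasFDerivAt.fun_sum fun p _ => HasFDerivAt.fun_sum fun x _ => ?_
  have hlin : HasFDerivAt (fun ψ' : EuclideanSpace ℝ ι => ω x + ψ' x) (EuclideanSpace.proj x : EuclideanSpace ℝ ι →L[ℝ] ℝ) ψ :=
    ((EuclideanSpace.proj x : EuclideanSpace ℝ ι →L[ℝ] ℝ).hasFDerivAt).const_add (ω x)
  exact (hw' x (ω x + ψ x)).comp_hasFDerivAt ψ hlin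

/-- **SIZE OF THE BASE DERIVATIVE**: `|w'_x(t)| ≤ κ₁|t|` (`κ₁ ≥ 0`), pairwise disjoint cells ⟹
`‖Σ_{p∈C}Σ_{x∈cell p}w'_x(ω_x+ψ_x)•proj_x‖ ≤ κ₁·(#Y + 2Σ_{x∈Y}ω_x² + 2Σ_{x∈Y}ψ_x²)`, `Y = ⋃_{p∈C}cell p`. [folklore] -/
theorem norm_cellDeriv_le (cell : V → Finset ι) (hdisj : ∀ p q, p ≠ q → Disjoint (cell p) (cell q)) {w' : ι → ℝ → ℝ} {κ₁ : ℝ}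
    (hκ₁ : 0 ≤ κ₁) (hw'b : ∀ x t, |w' x t| ≤ κ₁ * |t|) (C : Finset V) (ω ψ : EuclideanSpace ℝ ι) :
    ‖∑ p ∈ C, ∑ x ∈ cell p, (w' x (ω x + ψ x)) • (EuclideanSpace.proj x : EuclideanSpace ℝ ι →L[ℝ] ℝ)‖ ≤
      κ₁ * ((C.biUnion cell).card + 2 * ∑ x ∈ C.biUnion cell, ω x ^ 2 + 2 * ∑ x ∈ C.biUnion cell, ψ x ^ 2) := by
  -- the coordinate projections have operator norm `≤ 1` (the tree's `Literature.Analysis.PDE.norm_proj_le_one`, inlined) and `|t| ≤ 1 + t²`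
  have hproj : ∀ x, ‖(EuclideanSpace.proj x : EuclideanSpace ℝ ι →L[ℝ] ℝ)‖ ≤ 1 := fun x =>
    ContinuousLinearMap.opNorm_le_bound _ zero_le_one fun v => by
      rw [one_mul]
      exact PiLp.norm_apply_le v x
  have habs : ∀ t : ℝ, |t| ≤ 1 + t ^ 2 := fun t => by
    rcases le_or_gt (|t|) 1 with h | h
    · nlinarith [sq_nonneg t]
    · have : |t| ≤ |t| ^ 2 := by nlinarith
      rw [sq_abs] at this
      linarith
  have hterm : ∀ x, ‖(w' x (ω x + ψ x)) • (EuclideanSpace.proj x : EuclideanSpace ℝ ι →L[ℝ] ℝ)‖ ≤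
      κ₁ * (1 + 2 * ω x ^ 2 + 2 * ψ x ^ 2) := by
    intro x
    rw [norm_smul, Real.norm_eq_abs]
    calc |w' x (ω x + ψ x)| * ‖(EuclideanSpace.proj x : EuclideanSpace ℝ ι →L[ℝ] ℝ)‖
        ≤ κ₁ * |ω x + ψ x| * 1 := mul_le_mul (hw'b x _) (hproj x) (norm_nonneg _) (by positivity)
      _ ≤ κ₁ * (1 + (ω x + ψ x) ^ 2) := by rw [mul_one]; exact mul_le_mul_of_nonneg_left (habs _) hκ₁
      _ ≤ κ₁ * (1 + 2 * ω x ^ 2 + 2 * ψ x ^ 2) := by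
          refine mul_le_mul_of_nonneg_left ?_ hκ₁
          nlinarith [sq_nonneg (ω x - ψ x)]
  calc ‖∑ p ∈ C, ∑ x ∈ cell p, (w' x (ω x + ψ x)) • (EuclideanSpace.proj x : EuclideanSpace ℝ ι →L[ℝ] ℝ)‖
      ≤ ∑ p ∈ C, ‖∑ x ∈ cell p, (w' x (ω x + ψ x)) • (EuclideanSpace.proj x : EuclideanSpace ℝ ι →L[ℝ] ℝ)‖ := norm_sum_le _ _
    _ ≤ ∑ p ∈ C, ∑ x ∈ cell p, κ₁ * (1 + 2 * ω x ^ 2 + 2 * ψ x ^ 2) :=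
        sum_le_sum fun p _ => (norm_sum_le _ _).trans (sum_le_sum fun x _ => hterm x)
    _ = κ₁ * ((C.biUnion cell).card + 2 * ∑ x ∈ C.biUnion cell, ω x ^ 2 + 2 * ∑ x ∈ C.biUnion cell, ψ x ^ 2) := by
        rw [cellSum_eq_sum_biUnion cell hdisj C, ← mul_sum, sum_add_distrib, sum_add_distrib, sum_const, nsmul_eq_mul, mul_one,
          ← mul_sum, ← mul_sum]

omit [DecidableEq ι] in
/-- **In the unit ball about `ψ₀`**: `‖ψ − ψ₀‖ ≤ 1 ⟹ Σ_{x∈Y}ψ_x² ≤ 2Σ_{x∈Y}ψ₀,x² + 2`. [folklore] -/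
theorem sum_sq_ball_le (Y : Finset ι) {ψ ψ₀ : EuclideanSpace ℝ ι} (hψ : ‖ψ - ψ₀‖ ≤ 1) :
    ∑ x ∈ Y, ψ x ^ 2 ≤ 2 * ∑ x ∈ Y, ψ₀ x ^ 2 + 2 := by
  have hdiff : ∑ x ∈ Y, (ψ x - ψ₀ x) ^ 2 ≤ 1 := by
    calc ∑ x ∈ Y, (ψ x - ψ₀ x) ^ 2 ≤ ∑ x, (ψ x - ψ₀ x) ^ 2 :=
          sum_le_sum_of_subset_of_nonneg (subset_univ Y) fun _ _ _ => sq_nonneg _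
      _ = ‖ψ - ψ₀‖ ^ 2 := by
          rw [EuclideanSpace.real_norm_sq_eq]
          exact sum_congr rfl fun x _ => by simp only [WithLp.ofLp_sub, Pi.sub_apply]
      _ ≤ 1 := by nlinarith [norm_nonneg (ψ - ψ₀)]
  have hpt : ∀ x ∈ Y, ψ x ^ 2 ≤ 2 * ψ₀ x ^ 2 + 2 * (ψ x - ψ₀ x) ^ 2 := fun x _ => by nlinarith [sq_nonneg (ψ x - 2 * ψ₀ x)]
  calc ∑ x ∈ Y, ψ x ^ 2 ≤ ∑ x ∈ Y, (2 * ψ₀ x ^ 2 + 2 * (ψ x - ψ₀ x) ^ 2) := sum_le_sum hpt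
    _ = 2 * ∑ x ∈ Y, ψ₀ x ^ 2 + 2 * ∑ x ∈ Y, (ψ x - ψ₀ x) ^ 2 := by rw [sum_add_distrib, mul_sum, mul_sum]
    _ ≤ 2 * ∑ x ∈ Y, ψ₀ x ^ 2 + 2 := by linarith

/-- **Weakening an operator-bound hypothesis**: `0 ≤ a ≤ b`, `0 ≤ θ`, `bγ ≤ θ ⟹ aγ ≤ θ` (either sign of `γ`). [folklore] -/
theorem mul_opBound_le_of_le {a b γ θ : ℝ} (ha : 0 ≤ a) (hab : a ≤ b) (hθ : 0 ≤ θ) (h : b * γ ≤ θ) : a * γ ≤ θ := by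
  rcases le_or_gt 0 γ with hγ | hγ
  · exact (mul_le_mul_of_nonneg_right hab hγ).trans h
  · exact (mul_nonpos_of_nonneg_of_nonpos ha hγ.le).trans hθ

omit [Fintype ι] [DecidableEq ι] in
/-- The base derivative at `ψ₀` is an a.e.-strongly measurable function of `ω` (measurable `w'_x`). [folklore] -/
theorem aestronglyMeasurable_cellDeriv (μ : Measure (EuclideanSpace ℝ ι)) (cell : V → Finset ι) {w' : ι → ℝ → ℝ}
    (hw'm : ∀ x, Measurable (w' x)) (C : Finset V) (ψ : EuclideanSpace ℝ ι) :
    AEStronglyMeasurable (fun ω : EuclideanSpace ℝ ι =>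
      ∑ p ∈ C, ∑ x ∈ cell p, (w' x (ω x + ψ x)) • (EuclideanSpace.proj x : EuclideanSpace ℝ ι →L[ℝ] ℝ)) μ := by
  refine Finset.aestronglyMeasurable_fun_sum C fun p _ => Finset.aestronglyMeasurable_fun_sum (cell p) fun x _ => ?_
  have hc : Measurable fun ω : EuclideanSpace ℝ ι => w' x (ω x + ψ x) :=
    (hw'm x).comp ((by fun_prop : Measurable fun ω : EuclideanSpace ℝ ι => ω x).add_const (ψ x))
  exact hc.aestronglyMeasurable.smul aestronglyMeasurable_const

omit [Fintype ι] [DecidableEq ι] in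
/-- The base derivative applied to a direction `h`: `D(ψ,ω)h = Σ_{p∈C}Σ_{x∈cell p}w'_x(ω_x+ψ_x)h_x`. [folklore] -/
theorem cellDeriv_apply (cell : V → Finset ι) (w' : ι → ℝ → ℝ) (C : Finset V) (ω ψ h : EuclideanSpace ℝ ι) :
    (∑ p ∈ C, ∑ x ∈ cell p, (w' x (ω x + ψ x)) • (EuclideanSpace.proj x : EuclideanSpace ℝ ι →L[ℝ] ℝ)) h =
      ∑ p ∈ C, ∑ x ∈ cell p, w' x (ω x + ψ x) * h x := by
  simp only [_root_.sum_apply, _root_.smul_apply, smul_eq_mul]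
  rfl

/-! ## §2. The domination on the unit ball about `ψ₀` -/

/-- **THE DOMINATION**: stability (`κ₀ ≥ 0`), `|w'_x(t)| ≤ κ₁|t|` (`κ₁ ≥ 0`), `0 < τ`, `0 < δ`; for `‖ψ − ψ₀‖ ≤ 1` and every `ω`, with
`Y = ⋃_{p∈C}cell p`, `M = 2Σ_{x∈Y}ψ₀,x² + 2`:
`e^{−V(ψ,ω)}·‖D(ψ,ω)‖ ≤ κ₁e^{κ₀(1+τ⁻¹)M}(#Y + 2M + δ⁻¹)·e^{½(2κ₀(1+τ)+4δ)Σ_{x∈Y}ω_x²}`. [folklore] -/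
theorem step_domination (cell : V → Finset ι) (hdisj : ∀ p q, p ≠ q → Disjoint (cell p) (cell q)) {w w' : ι → ℝ → ℝ}
    {κ₀ κ₁ τ δ : ℝ} (hκ₀ : 0 ≤ κ₀) (hκ₁ : 0 ≤ κ₁) (hτ : 0 < τ) (hδ : 0 < δ) (hstab : ∀ x, ∀ t : ℝ, -(κ₀ * t ^ 2) ≤ w x t)
    (hw'b : ∀ x t, |w' x t| ≤ κ₁ * |t|) (C : Finset V) (ψ₀ ψ : EuclideanSpace ℝ ι) (hψ : ‖ψ - ψ₀‖ ≤ 1) (ω : EuclideanSpace ℝ ι) :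
    exp (-(∑ p ∈ C, ∑ x ∈ cell p, w x (ω x + ψ x))) *
        ‖∑ p ∈ C, ∑ x ∈ cell p, (w' x (ω x + ψ x)) • (EuclideanSpace.proj x : EuclideanSpace ℝ ι →L[ℝ] ℝ)‖ ≤
      κ₁ * exp (κ₀ * (1 + τ⁻¹) * (2 * ∑ x ∈ C.biUnion cell, ψ₀ x ^ 2 + 2)) *
        ((C.biUnion cell).card + 2 * (2 * ∑ x ∈ C.biUnion cell, ψ₀ x ^ 2 + 2) + δ⁻¹) *
        exp ((2 * κ₀ * (1 + τ) + 4 * δ) * (∑ x ∈ C.biUnion cell, ω x ^ 2) / 2) := by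
  set Y := C.biUnion cell with hY
  set M : ℝ := 2 * ∑ x ∈ Y, ψ₀ x ^ 2 + 2 with hM
  set Sω : ℝ := ∑ x ∈ Y, ω x ^ 2 with hSω
  have hSω0 : 0 ≤ Sω := sum_nonneg fun x _ => sq_nonneg _
  have hM0 : 0 ≤ M := by rw [hM]; positivity
  have hψM : ∑ x ∈ Y, ψ x ^ 2 ≤ M := sum_sq_ball_le Y hψ
  -- the exponent: stability + Young
  have hV : -(∑ p ∈ C, ∑ x ∈ cell p, w x (ω x + ψ x)) ≤ κ₀ * (1 + τ) * Sω + κ₀ * (1 + τ⁻¹) * M := by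
    rw [cellSum_eq_sum_biUnion cell hdisj C]
    have h := neg_sum_le_of_stable Y w hκ₀ hτ hstab (fun x => ω x) (fun x => ψ x)
    have h2 : κ₀ * (1 + τ⁻¹) * ∑ x ∈ Y, ψ x ^ 2 ≤ κ₀ * (1 + τ⁻¹) * M := mul_le_mul_of_nonneg_left hψM (by positivity)
    linarith
  -- the derivative
  have hD := norm_cellDeriv_le cell hdisj hκ₁ hw'b C ω ψ
  have hD' : ‖∑ p ∈ C, ∑ x ∈ cell p, (w' x (ω x + ψ x)) • (EuclideanSpace.proj x : EuclideanSpace ℝ ι →L[ℝ] ℝ)‖ ≤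
      κ₁ * ((Y.card : ℝ) + 2 * M + 2 * Sω) := by
    refine hD.trans (mul_le_mul_of_nonneg_left ?_ hκ₁)
    linarith
  -- `2Σω² ≤ δ⁻¹e^{2δΣω²}` and the polynomial prefactor under one exponential
  have hpoly : (Y.card : ℝ) + 2 * M + 2 * Sω ≤ ((Y.card : ℝ) + 2 * M + δ⁻¹) * exp (2 * δ * Sω) := by
    have h1 : 1 ≤ exp (2 * δ * Sω) := one_le_exp_iff.2 (by positivity)
    have h2 : 2 * δ * Sω ≤ exp (2 * δ * Sω) := by linarith [add_one_le_exp (2 * δ * Sω)]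
    have h3 : 2 * Sω ≤ δ⁻¹ * exp (2 * δ * Sω) := by
      rw [le_inv_mul_iff₀' hδ]
      linarith
    have h4 : (Y.card : ℝ) + 2 * M ≤ ((Y.card : ℝ) + 2 * M) * exp (2 * δ * Sω) := le_mul_of_one_le_right (by positivity) h1
    nlinarith
  calc exp (-(∑ p ∈ C, ∑ x ∈ cell p, w x (ω x + ψ x))) *
        ‖∑ p ∈ C, ∑ x ∈ cell p, (w' x (ω x + ψ x)) • (EuclideanSpace.proj x : EuclideanSpace ℝ ι →L[ℝ] ℝ)‖
      ≤ exp (κ₀ * (1 + τ) * Sω + κ₀ * (1 + τ⁻¹) * M) * (κ₁ * (((Y.card : ℝ) + 2 * M + δ⁻¹) * exp (2 * δ * Sω))) :=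
        mul_le_mul (exp_le_exp.2 hV) (hD'.trans (mul_le_mul_of_nonneg_left hpoly hκ₁)) (norm_nonneg _) (exp_pos _).le
    _ = κ₁ * exp (κ₀ * (1 + τ⁻¹) * M) * ((Y.card : ℝ) + 2 * M + δ⁻¹) * exp ((2 * κ₀ * (1 + τ) + 4 * δ) * Sω / 2) := by
        have he : exp (κ₀ * (1 + τ) * Sω + κ₀ * (1 + τ⁻¹) * M) * exp (2 * δ * Sω) =
            exp (κ₀ * (1 + τ⁻¹) * M) * exp ((2 * κ₀ * (1 + τ) + 4 * δ) * Sω / 2) := by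
          rw [← exp_add, ← exp_add]
          congr 1
          ring
        calc exp (κ₀ * (1 + τ) * Sω + κ₀ * (1 + τ⁻¹) * M) * (κ₁ * (((Y.card : ℝ) + 2 * M + δ⁻¹) * exp (2 * δ * Sω)))
            = κ₁ * ((Y.card : ℝ) + 2 * M + δ⁻¹) * (exp (κ₀ * (1 + τ) * Sω + κ₀ * (1 + τ⁻¹) * M) * exp (2 * δ * Sω)) := by ring
          _ = _ := by rw [he]; ring

/-- **The dominating function is integrable** under `N(0,Γ)` (`Γ ⪰ 0`, `Γ ⪯ γ_op·1`, `(2κ₀(1+τ)+4δ)γ_op ≤ θ < 1`). [folklore] -/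
theorem integrable_domination {Γ : Matrix ι ι ℝ} {γop : ℝ} (hΓ : Γ.PosSemidef) (hΓop : (γop • (1 : Matrix ι ι ℝ) - Γ).PosSemidef)
    (Y : Finset ι) {κ₀ τ δ θ : ℝ} (hκ₀ : 0 ≤ κ₀) (hτ : 0 < τ) (hδ : 0 < δ) (hθ1 : θ < 1)
    (hκθ : (2 * κ₀ * (1 + τ) + 4 * δ) * γop ≤ θ) (K : ℝ) :
    Integrable (fun ω : EuclideanSpace ℝ ι => K * exp ((2 * κ₀ * (1 + τ) + 4 * δ) * (∑ x ∈ Y, ω x ^ 2) / 2))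
      (multivariateGaussian 0 Γ) :=
  (integrable_exp_half_sq_on hΓ hΓop (by positivity) hθ1 hκθ Y).const_mul K

/-! ## §3. THE END: the effective action is differentiable at every external field -/

section TheEnd

variable {Γ : Matrix ι ι ℝ} {γop : ℝ} {cell : V → Finset ι} {w w' : ι → ℝ → ℝ} {κ₀ κ₁ τ δ θ : ℝ}

/-- **THE STEP IS DIFFERENTIABLE IN THE EXTERNAL FIELD**: `Γ ⪰ 0`, `Γ ⪯ γ_op·1`; pairwise disjoint cells; `C¹` remainders with measurable
derivatives, `|w'_x(t)| ≤ κ₁|t|` (`κ₁ ≥ 0`), `−κ₀t² ≤ w_x(t)` (`κ₀ ≥ 0`); `0 < τ`, `0 < δ`, `0 < θ < 1`, `(2κ₀(1+τ)+4δ)γ_op ≤ θ` ⟹ at EVERY `ψ₀`,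
`HasFDerivAt (ψ ↦ ∫e^{−V(ψ,ω)}dN(0,Γ)) (−∫ e^{−V(ψ₀,ω)} • D(ψ₀,ω) dN(0,Γ)) ψ₀`. [folklore] -/
theorem hasFDerivAt_step (hΓ : Γ.PosSemidef) (hΓop : (γop • (1 : Matrix ι ι ℝ) - Γ).PosSemidef)
    (hdisj : ∀ p q, p ≠ q → Disjoint (cell p) (cell q)) (hw' : ∀ x t, HasDerivAt (w x) (w' x t) t) (hw'm : ∀ x, Measurable (w' x))
    (hκ₀ : 0 ≤ κ₀) (hκ₁ : 0 ≤ κ₁) (hτ : 0 < τ) (hδ : 0 < δ) (hθ0 : 0 < θ) (hθ1 : θ < 1)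
    (hκθ : (2 * κ₀ * (1 + τ) + 4 * δ) * γop ≤ θ) (hstab : ∀ x, ∀ t : ℝ, -(κ₀ * t ^ 2) ≤ w x t)
    (hw'b : ∀ x t, |w' x t| ≤ κ₁ * |t|) (C : Finset V) (ψ₀ : EuclideanSpace ℝ ι) :
    HasFDerivAt (fun ψ : EuclideanSpace ℝ ι =>
        ∫ ω : EuclideanSpace ℝ ι, exp (-(∑ p ∈ C, ∑ x ∈ cell p, w x (ω x + ψ x))) ∂(multivariateGaussian 0 Γ))
      (-∫ ω : EuclideanSpace ℝ ι, exp (-(∑ p ∈ C, ∑ x ∈ cell p, w x (ω x + ψ₀ x))) •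
        (∑ p ∈ C, ∑ x ∈ cell p, (w' x (ω x + ψ₀ x)) • (EuclideanSpace.proj x : EuclideanSpace ℝ ι →L[ℝ] ℝ))
        ∂(multivariateGaussian 0 Γ)) ψ₀ := by
  have hw : ∀ x, Measurable (w x) := fun x => (continuous_iff_continuousAt.2 fun t => (hw' x t).continuousAt).measurable
  have hκθ₀ : 2 * κ₀ * (1 + τ) * γop ≤ θ :=
    mul_opBound_le_of_le (by positivity) (by linarith) hθ0.le hκθ
  have hI : Integrable (fun ω : EuclideanSpace ℝ ι => exp (-(∑ p ∈ C, ∑ x ∈ cell p, w x (ω x + ψ₀ x))))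
      (multivariateGaussian 0 Γ) := by
    have h := integrable_exp_neg hΓ hΓop (C.biUnion cell) w hw hκ₀ hτ hθ1 hκθ₀ hstab (fun x => ψ₀ x)
    refine h.congr (ae_of_all _ fun ω => ?_)
    simp only
    rw [cellSum_eq_sum_biUnion cell hdisj C]
  exact hasFDerivAt_fibreIntegral (μ := multivariateGaussian 0 Γ)
    (V := fun q : EuclideanSpace ℝ ι × EuclideanSpace ℝ ι => ∑ p ∈ C, ∑ x ∈ cell p, w x (q.2 x + q.1 x))
    (Vx := fun q : EuclideanSpace ℝ ι × EuclideanSpace ℝ ι =>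
      ∑ p ∈ C, ∑ x ∈ cell p, (w' x (q.2 x + q.1 x)) • (EuclideanSpace.proj x : EuclideanSpace ℝ ι →L[ℝ] ℝ))
    (x₀ := ψ₀) (U := closedBall ψ₀ 1) (closedBall_mem_nhds ψ₀ one_pos)
    (fun ψ _ => (measurable_cellSum cell w hw C (fun x => ψ x)).aestronglyMeasurable) hI
    (aestronglyMeasurable_cellDeriv _ cell hw'm C ψ₀) (fun ψ _ ω => hasFDerivAt_cellSum cell hw' C ω ψ)
    (integrable_domination hΓ hΓop (C.biUnion cell) hκ₀ hτ hδ hθ1 hκθ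
      (κ₁ * exp (κ₀ * (1 + τ⁻¹) * (2 * ∑ x ∈ C.biUnion cell, ψ₀ x ^ 2 + 2)) *
        ((C.biUnion cell).card + 2 * (2 * ∑ x ∈ C.biUnion cell, ψ₀ x ^ 2 + 2) + δ⁻¹)))
    (fun ψ hψ ω => by
      rw [mem_closedBall, dist_eq_norm] at hψ
      exact step_domination cell hdisj hκ₀ hκ₁ hτ hδ hstab hw'b C ψ₀ ψ hψ ω)

/-- **THE END — THE EFFECTIVE ACTION OF THE STEP IS DIFFERENTIABLE AT EVERY EXTERNAL FIELD, WITH DERIVATIVE THE TILTED MEAN OF THE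
REMAINDER'S DERIVATIVE.**  Under the hypotheses of `hasFDerivAt_step`, at EVERY `ψ₀`:
`HasFDerivAt (ψ ↦ −log ∫e^{−Σ_{p∈C}Σ_{x∈cell p}w_x(ω_x+ψ_x)}dN(0,Γ)) (Z(ψ₀)⁻¹ • ∫ e^{−V(ψ₀,ω)} • Σ_{p∈C}Σ_{x∈cell p}w'_x(ω_x+ψ₀,x)•proj_x dN(0,Γ)) ψ₀`.
[folklore] -/
theorem hasFDerivAt_neg_log_step (hΓ : Γ.PosSemidef) (hΓop : (γop • (1 : Matrix ι ι ℝ) - Γ).PosSemidef)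
    (hdisj : ∀ p q, p ≠ q → Disjoint (cell p) (cell q)) (hw' : ∀ x t, HasDerivAt (w x) (w' x t) t) (hw'm : ∀ x, Measurable (w' x))
    (hκ₀ : 0 ≤ κ₀) (hκ₁ : 0 ≤ κ₁) (hτ : 0 < τ) (hδ : 0 < δ) (hθ0 : 0 < θ) (hθ1 : θ < 1)
    (hκθ : (2 * κ₀ * (1 + τ) + 4 * δ) * γop ≤ θ) (hstab : ∀ x, ∀ t : ℝ, -(κ₀ * t ^ 2) ≤ w x t)
    (hw'b : ∀ x t, |w' x t| ≤ κ₁ * |t|) (C : Finset V) (ψ₀ : EuclideanSpace ℝ ι) :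
    HasFDerivAt (fun ψ : EuclideanSpace ℝ ι =>
        -log (∫ ω : EuclideanSpace ℝ ι, exp (-(∑ p ∈ C, ∑ x ∈ cell p, w x (ω x + ψ x))) ∂(multivariateGaussian 0 Γ)))
      ((∫ ω : EuclideanSpace ℝ ι, exp (-(∑ p ∈ C, ∑ x ∈ cell p, w x (ω x + ψ₀ x))) ∂(multivariateGaussian 0 Γ))⁻¹ •
        ∫ ω : EuclideanSpace ℝ ι, exp (-(∑ p ∈ C, ∑ x ∈ cell p, w x (ω x + ψ₀ x))) •
          (∑ p ∈ C, ∑ x ∈ cell p, (w' x (ω x + ψ₀ x)) • (EuclideanSpace.proj x : EuclideanSpace ℝ ι →L[ℝ] ℝ))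
          ∂(multivariateGaussian 0 Γ)) ψ₀ := by
  have hw : ∀ x, Measurable (w x) := fun x => (continuous_iff_continuousAt.2 fun t => (hw' x t).continuousAt).measurable
  have hκθ₀ : 2 * κ₀ * (1 + τ) * γop ≤ θ :=
    mul_opBound_le_of_le (by positivity) (by linarith) hθ0.le hκθ
  have hI : Integrable (fun ω : EuclideanSpace ℝ ι => exp (-(∑ p ∈ C, ∑ x ∈ cell p, w x (ω x + ψ₀ x))))
      (multivariateGaussian 0 Γ) := by
    have h := integrable_exp_neg hΓ hΓop (C.biUnion cell) w hw hκ₀ hτ hθ1 hκθ₀ hstab (fun x => ψ₀ x)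
    refine h.congr (ae_of_all _ fun ω => ?_)
    simp only
    rw [cellSum_eq_sum_biUnion cell hdisj C]
  have hZ : 0 < ∫ ω : EuclideanSpace ℝ ι, exp (-(∑ p ∈ C, ∑ x ∈ cell p, w x (ω x + ψ₀ x))) ∂(multivariateGaussian 0 Γ) :=
    integral_exp_pos hI
  exact hasFDerivAt_neg_log_fibreIntegral (μ := multivariateGaussian 0 Γ)
    (V := fun q : EuclideanSpace ℝ ι × EuclideanSpace ℝ ι => ∑ p ∈ C, ∑ x ∈ cell p, w x (q.2 x + q.1 x))
    (Vx := fun q : EuclideanSpace ℝ ι × EuclideanSpace ℝ ι =>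
      ∑ p ∈ C, ∑ x ∈ cell p, (w' x (q.2 x + q.1 x)) • (EuclideanSpace.proj x : EuclideanSpace ℝ ι →L[ℝ] ℝ))
    (x₀ := ψ₀) (U := closedBall ψ₀ 1) (closedBall_mem_nhds ψ₀ one_pos)
    (fun ψ _ => (measurable_cellSum cell w hw C (fun x => ψ x)).aestronglyMeasurable) hI
    (aestronglyMeasurable_cellDeriv _ cell hw'm C ψ₀) (fun ψ _ ω => hasFDerivAt_cellSum cell hw' C ω ψ)
    (integrable_domination hΓ hΓop (C.biUnion cell) hκ₀ hτ hδ hθ1 hκθ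
      (κ₁ * exp (κ₀ * (1 + τ⁻¹) * (2 * ∑ x ∈ C.biUnion cell, ψ₀ x ^ 2 + 2)) *
        ((C.biUnion cell).card + 2 * (2 * ∑ x ∈ C.biUnion cell, ψ₀ x ^ 2 + 2) + δ⁻¹)))
    (fun ψ hψ ω => by
      rw [mem_closedBall, dist_eq_norm] at hψ
      exact step_domination cell hdisj hκ₀ hκ₁ hτ hδ hstab hw'b C ψ₀ ψ hψ ω) hZ

/-- **The weighted derivative is Bochner integrable** (dominated on the ball, in particular at its centre), so the tilted mean in
`hasFDerivAt_neg_log_step` is a genuine integral of the `CLM`-valued integrand. [folklore] -/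
theorem integrable_weighted_cellDeriv (hΓ : Γ.PosSemidef) (hΓop : (γop • (1 : Matrix ι ι ℝ) - Γ).PosSemidef)
    (hdisj : ∀ p q, p ≠ q → Disjoint (cell p) (cell q)) (hw' : ∀ x t, HasDerivAt (w x) (w' x t) t) (hw'm : ∀ x, Measurable (w' x))
    (hκ₀ : 0 ≤ κ₀) (hκ₁ : 0 ≤ κ₁) (hτ : 0 < τ) (hδ : 0 < δ) (hθ1 : θ < 1)
    (hκθ : (2 * κ₀ * (1 + τ) + 4 * δ) * γop ≤ θ) (hstab : ∀ x, ∀ t : ℝ, -(κ₀ * t ^ 2) ≤ w x t)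
    (hw'b : ∀ x t, |w' x t| ≤ κ₁ * |t|) (C : Finset V) (ψ₀ : EuclideanSpace ℝ ι) :
    Integrable (fun ω : EuclideanSpace ℝ ι => exp (-(∑ p ∈ C, ∑ x ∈ cell p, w x (ω x + ψ₀ x))) •
      (∑ p ∈ C, ∑ x ∈ cell p, (w' x (ω x + ψ₀ x)) • (EuclideanSpace.proj x : EuclideanSpace ℝ ι →L[ℝ] ℝ)))
      (multivariateGaussian 0 Γ) := by
  have hw : ∀ x, Measurable (w x) := fun x => (continuous_iff_continuousAt.2 fun t => (hw' x t).continuousAt).measurable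
  have hmeas : AEStronglyMeasurable (fun ω : EuclideanSpace ℝ ι => exp (-(∑ p ∈ C, ∑ x ∈ cell p, w x (ω x + ψ₀ x))) •
      (∑ p ∈ C, ∑ x ∈ cell p, (w' x (ω x + ψ₀ x)) • (EuclideanSpace.proj x : EuclideanSpace ℝ ι →L[ℝ] ℝ)))
      (multivariateGaussian 0 Γ) :=
    (continuous_exp.comp_aestronglyMeasurable (measurable_cellSum cell w hw C (fun x => ψ₀ x)).aestronglyMeasurable.neg).smul
      (aestronglyMeasurable_cellDeriv _ cell hw'm C ψ₀)
  refine (integrable_domination hΓ hΓop (C.biUnion cell) hκ₀ hτ hδ hθ1 hκθ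
    (κ₁ * exp (κ₀ * (1 + τ⁻¹) * (2 * ∑ x ∈ C.biUnion cell, ψ₀ x ^ 2 + 2)) *
        ((C.biUnion cell).card + 2 * (2 * ∑ x ∈ C.biUnion cell, ψ₀ x ^ 2 + 2) + δ⁻¹))).mono' hmeas (ae_of_all _ fun ω => ?_)
  rw [norm_smul, Real.norm_eq_abs, abs_of_pos (exp_pos _)]
  exact step_domination cell hdisj hκ₀ hκ₁ hτ hδ hstab hw'b C ψ₀ ψ₀ (by rw [sub_self, norm_zero]; exact zero_le_one) ω

/-- **THE DERIVATIVE IN A DIRECTION `h` IS THE TILTED MEAN OF `Σ w'_x(ω_x+ψ₀,x)h_x`**: under the hypotheses of `hasFDerivAt_step`,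
`(Z⁻¹ • ∫ e^{−V} • D dμ) h = Z⁻¹ · ∫ e^{−V(ψ₀,ω)}·Σ_{p∈C}Σ_{x∈cell p}w'_x(ω_x+ψ₀,x)h_x dμ`. [folklore] -/
theorem fderiv_neg_log_step_apply (hΓ : Γ.PosSemidef) (hΓop : (γop • (1 : Matrix ι ι ℝ) - Γ).PosSemidef)
    (hdisj : ∀ p q, p ≠ q → Disjoint (cell p) (cell q)) (hw' : ∀ x t, HasDerivAt (w x) (w' x t) t) (hw'm : ∀ x, Measurable (w' x))
    (hκ₀ : 0 ≤ κ₀) (hκ₁ : 0 ≤ κ₁) (hτ : 0 < τ) (hδ : 0 < δ) (hθ1 : θ < 1)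
    (hκθ : (2 * κ₀ * (1 + τ) + 4 * δ) * γop ≤ θ) (hstab : ∀ x, ∀ t : ℝ, -(κ₀ * t ^ 2) ≤ w x t)
    (hw'b : ∀ x t, |w' x t| ≤ κ₁ * |t|) (C : Finset V) (ψ₀ h : EuclideanSpace ℝ ι) :
    ((∫ ω : EuclideanSpace ℝ ι, exp (-(∑ p ∈ C, ∑ x ∈ cell p, w x (ω x + ψ₀ x))) ∂(multivariateGaussian 0 Γ))⁻¹ •
        ∫ ω : EuclideanSpace ℝ ι, exp (-(∑ p ∈ C, ∑ x ∈ cell p, w x (ω x + ψ₀ x))) •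
          (∑ p ∈ C, ∑ x ∈ cell p, (w' x (ω x + ψ₀ x)) • (EuclideanSpace.proj x : EuclideanSpace ℝ ι →L[ℝ] ℝ))
          ∂(multivariateGaussian 0 Γ)) h =
      (∫ ω : EuclideanSpace ℝ ι, exp (-(∑ p ∈ C, ∑ x ∈ cell p, w x (ω x + ψ₀ x))) ∂(multivariateGaussian 0 Γ))⁻¹ *
        ∫ ω : EuclideanSpace ℝ ι, exp (-(∑ p ∈ C, ∑ x ∈ cell p, w x (ω x + ψ₀ x))) *
          (∑ p ∈ C, ∑ x ∈ cell p, w' x (ω x + ψ₀ x) * h x) ∂(multivariateGaussian 0 Γ) := by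
  rw [smul_apply, ContinuousLinearMap.integral_apply
    (integrable_weighted_cellDeriv hΓ hΓop hdisj hw' hw'm hκ₀ hκ₁ hτ hδ hθ1 hκθ hstab hw'b C ψ₀), smul_eq_mul]
  congr 1
  refine integral_congr_ae (ae_of_all _ fun ω => ?_)
  simp only [smul_apply, smul_eq_mul, cellDeriv_apply]

end TheEnd

/-! ## §4. Toy -/

/-- Toy (§1): weakening an operator bound, `0 ≤ 1 ≤ 2`, `2γ ≤ θ`, `0 ≤ θ ⟹ 1·γ ≤ θ`. -/
example (γ θ : ℝ) (hθ : 0 ≤ θ) (h : 2 * γ ≤ θ) : 1 * γ ≤ θ := mul_opBound_le_of_le zero_le_one (by norm_num) hθ h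

end Summit.QuantumFields.BalabanUV.T4Continuum.NE7b.SupEffectiveActionDerivative
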